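/-
Copyright (c) 2026. All rights reserved.
Released under Apache 2.0 license as described in the file LICENSE.
-/
import Mathlib
import Summits.MatrixMultiplication.MatrixMultiplication.Theorems.SubgroupIdentityDesigns.Negative.DicksonTheorem
import Summits.MatrixMultiplication.MatrixMultiplication.Theorems.SubgroupIdentityDesigns.Negative.TwoPointActionsSharp

/-!
# Dickson's list, sharp form: exceptional `p`-free subgroups of `GL₂(𝔽_p)` contain `-1` and have
# projective image of order exactly `12`, `24` or `60`

Route `LevelGradedCohnUmans`, crux `SubgroupIdentityDesigns` (stmt-MatrixMultiplication-14079), the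
`(m,k) = (2,1)` cell.  VALUE = THEOREM, NOT summit progress: the crux stays open and untouched.

`DicksonTheorem.dicksonList_holds` gives, for a `p`-free `H ≤ GL₂(𝔽_p)` (`p` odd): conjugate into
the monomial group, or into the normaliser of a non-split torus, or projective image of order
`≤ 60`.  Here the third branch is sharpened to what the small-prime order sieve needs:

* `two_point_action_sharp` (abstract) gives `|H| = |H ∩ Z| · N`, `N ∈ {12, 24, 60}`, and every
  element of `H / (H ∩ Z)` has order dividing `2`, `3`, `4` (only if `N = 24`) or `5` (only if
  `N = 60`);
* **parity law** `neg_one_mem_of_exceptional`: such an `H` contains `-1`.  Proof: if `-1 ∉ H` then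
  `H ∩ Z` has odd order, so a `2`-subgroup `Q ≤ H` of order `4` (`N = 12, 60`) or `8` (`N = 24`)
  meets the scalars trivially; a `2`-subgroup of `GL₂(𝔽_p)` meeting `Z` trivially embeds into
  `𝔽_pˣ` by the DETERMINANT (a non-scalar involution has determinant `-1`, so the kernel of `det`
  on `Q` has no involution, hence is trivial) and is therefore cyclic; a generator has order `4`
  resp. `8` in `H / (H ∩ Z)`, contradicting the element orders above;
* **`dickson_sharp`**: the packaged trichotomy with `-1 ∈ H` and image order `= 12, 24, 60` in
  the exceptional branch.

Consequence for a `(2,1)` witness: by `ScalarLaw.neg_one_mem_atMostOne` at most one member is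
exceptional, and by `CartanMembers` (p ≥ 7) at least one is.

Report: `run/shared/lean/b2b/levelgraded-cu/ORACLE-g17.md`.
-/

set_option linter.dupNamespace false

noncomputable section

open scoped BigOperators Classical

open Summit.MatrixMultiplication.MatrixMultiplication.Theorems.LieRankDesigns.Negative (GLm Mat budget)
open Literature.Barriers.MatrixMultiplication (SubgroupTPP)

namespace Summit.MatrixMultiplication.MatrixMultiplication.Theorems.SubgroupIdentityDesigns.Negative

section ExceptionalParity

variable {p : ℕ} [hp : Fact p.Prime]

/-! ### Involutions have determinant `-1` -/

/-- A non-scalar `2 × 2` matrix with `M² = 1` has determinant `-1` (Cayley–Hamilton: its trace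
vanishes). -/
theorem det_eq_neg_one_of_sq_eq_one {M : Mat p 2} (h : M * M = 1)
    (hns : ¬ (M 0 1 = 0 ∧ M 1 0 = 0 ∧ M 1 1 = M 0 0)) : M.det = -1 := by
  have h' : M * M = (1 : ZMod p) • (1 : Mat p 2) := by rw [h, one_smul]
  have htr := trace_zero_of_sq h' hns
  have key := mat2_sq_eq M
  rw [htr, zero_smul, zero_sub, h] at key
  have e00 := congrArg (fun A : Mat p 2 => A 0 0) key
  simp only [Matrix.neg_apply, Matrix.smul_apply, smul_eq_mul, Matrix.one_apply_eq, mul_one] at e00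
  rw [Matrix.det_fin_two]
  linear_combination e00

/-! ### The kernel of the action on `ℙ¹(K̄)` is the scalar part -/

/-- An element of `H` acts trivially on `ℙ¹(K̄)` iff it is a scalar matrix. -/
theorem mem_actKer_iff_mem_range (H : Subgroup (GLm p 2)) (γ : H) :
    γ ∈ actKer H (PL p) ↔ (γ : GLm p 2) ∈ (scalarHom p 2).range := by
  constructor
  · intro hγ
    have h' : ∀ x : PL p, ((γ : H) : GLm p 2) • x = x := fun x => by
      rw [← Subgroup.smul_def]; exact mem_actKer.mp hγ x
    exact mem_range_scalarHom_of_forall_smul h'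
  · intro hmem
    rw [mem_actKer]
    intro x
    rw [Subgroup.smul_def]
    exact smul_eq_self_of_mem_range hmem x

/-- The kernel of `H` on `ℙ¹(K̄)` has the order of the scalar part `H ∩ Z`. -/
theorem card_actKer_eq (H : Subgroup (GLm p 2)) :
    Nat.card (actKer H (PL p)) = Nat.card (H.comap (scalarHom p 2)) := by
  refine le_antisymm (card_actKer_le H) ?_
  have hmem : ∀ u : H.comap (scalarHom p 2), scalarHom p 2 (u : (ZMod p)ˣ) ∈ H := fun u =>
    Subgroup.mem_comap.mp u.2
  have hker : ∀ u : H.comap (scalarHom p 2),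
      (⟨scalarHom p 2 (u : (ZMod p)ˣ), hmem u⟩ : H) ∈ actKer H (PL p) := by
    intro u
    rw [mem_actKer_iff_mem_range]
    exact MonoidHom.mem_range.mpr ⟨(u : (ZMod p)ˣ), rfl⟩
  refine Nat.card_le_card_of_injective (fun u => (⟨_, hker u⟩ : actKer H (PL p)))
    fun u v huv => ?_
  apply Subtype.ext
  apply scalarHom_injective (p := p) (m := 2)
  have := congrArg (fun a : actKer H (PL p) => ((a : H) : GLm p 2)) huv
  exact this

/-! ### The scalar part of a subgroup without `-1` is odd -/

/-- If `-1 ∉ H` then the scalar part `H ∩ Z` has odd order. -/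
theorem not_two_dvd_card_comap_of_neg_one_not_mem {H : Subgroup (GLm p 2)}
    (hneg : scalarHom p 2 (-1) ∉ H) : ¬ 2 ∣ Nat.card (H.comap (scalarHom p 2)) := by
  intro h2
  haveI : Fact (Nat.Prime 2) := ⟨Nat.prime_two⟩
  obtain ⟨u, hu⟩ := exists_prime_orderOf_dvd_card' 2 h2
  have hu2 : u ^ 2 = 1 := by have := pow_orderOf_eq_one u; rwa [hu] at this
  have hu1 : u ≠ 1 := by
    intro h1
    rw [h1, orderOf_one] at hu
    exact absurd hu (by norm_num)
  have hval : ((u : (ZMod p)ˣ) : ZMod p) * ((u : (ZMod p)ˣ) : ZMod p) = 1 := by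
    have := congrArg (fun a : H.comap (scalarHom p 2) => ((a : (ZMod p)ˣ) : ZMod p)) hu2
    simpa [sq] using this
  rcases mul_self_eq_one_iff.mp hval with h | h
  · apply hu1
    apply Subtype.ext
    exact Units.ext (by simpa using h)
  · have hneg1 : (u : (ZMod p)ˣ) = -1 := Units.ext (by simpa using h)
    apply hneg
    rw [← hneg1]
    exact Subgroup.mem_comap.mp u.2

/-- In a subgroup `Q ≤ H` of `2`-power order, where `H ∩ Z` is odd, the only scalar is `1`. -/
theorem eq_one_of_mem_two_subgroup {H : Subgroup (GLm p 2)}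
    (hodd : ¬ 2 ∣ Nat.card (H.comap (scalarHom p 2)))
    {Q : Subgroup (GLm p 2)} (hQH : Q ≤ H) {a : ℕ} (hQ : Nat.card Q = 2 ^ a)
    {q : GLm p 2} (hq : q ∈ Q) (hsc : q ∈ (scalarHom p 2).range) : q = 1 := by
  obtain ⟨u, rfl⟩ := hsc
  have h1 : orderOf (scalarHom p 2 u) ∣ 2 ^ a := hQ ▸ Q.orderOf_dvd_natCard hq
  have hu : u ∈ H.comap (scalarHom p 2) := Subgroup.mem_comap.mpr (hQH hq)
  have h2 : orderOf u ∣ Nat.card (H.comap (scalarHom p 2)) :=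
    (H.comap (scalarHom p 2)).orderOf_dvd_natCard hu
  have h12 : orderOf (scalarHom p 2 u) = orderOf u := orderOf_injective _ scalarHom_injective u
  rw [h12] at h1
  have hcop : Nat.Coprime (2 ^ a) (Nat.card (H.comap (scalarHom p 2))) := by
    apply Nat.Coprime.pow_left
    exact (Nat.Prime.coprime_iff_not_dvd Nat.prime_two).mpr hodd
  have : orderOf u = 1 := Nat.Coprime.eq_one_of_dvd (Nat.Coprime.coprime_dvd_left h1 hcop) h2
  rw [orderOf_eq_one_iff] at this
  rw [this, map_one]

/-! ### A `2`-subgroup of `GL₂(𝔽_p)` meeting the scalars trivially is cyclic -/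

/-- **A `2`-subgroup of `GL₂(𝔽_p)` (`p` odd) containing no scalar `≠ 1` is cyclic**: it embeds
into `𝔽_p` by the determinant, because the kernel of `det` on it contains no involution
(a non-scalar involution has determinant `-1 ≠ 1`). -/
theorem isCyclic_of_two_subgroup (hp2 : p ≠ 2) {Q : Subgroup (GLm p 2)} {a : ℕ}
    (hQ : Nat.card Q = 2 ^ a) (hsc : ∀ q ∈ Q, q ∈ (scalarHom p 2).range → q = 1) :
    IsCyclic Q := by
  haveI : Fact (Nat.Prime 2) := ⟨Nat.prime_two⟩
  have hPG : IsPGroup 2 Q := IsPGroup.of_card hQ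
  let f : Q →* ZMod p :=
    (Units.coeHom (ZMod p)).comp (Matrix.GeneralLinearGroup.det.comp Q.subtype)
  have hf : ∀ q : Q, f q = ((q : GLm p 2) : Mat p 2).det := fun q => rfl
  -- an element of `Q` with determinant `1` is trivial
  have key : ∀ q : Q, f q = 1 → q = 1 := by
    intro q hq1
    obtain ⟨k, hk⟩ := hPG q
    induction k with
    | zero => simpa using hk
    | succ k ih =>
      apply ih
      set t : Q := q ^ 2 ^ k with htdef
      have htt : t * t = 1 := by rw [htdef, ← pow_add, ← two_mul, ← pow_succ']; exact hk
      have hft : f t = 1 := by rw [htdef, map_pow, hq1, one_pow]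
      -- `t` is an involution of determinant `1`, hence scalar, hence `1`
      have hTT : ((t : GLm p 2) : Mat p 2) * ((t : GLm p 2) : Mat p 2) = 1 := by
        have := congrArg (fun x : Q => ((x : GLm p 2) : Mat p 2)) htt
        simpa [Units.val_mul] using this
      by_cases hns : ((t : GLm p 2) : Mat p 2) 0 1 = 0 ∧ ((t : GLm p 2) : Mat p 2) 1 0 = 0 ∧
          ((t : GLm p 2) : Mat p 2) 1 1 = ((t : GLm p 2) : Mat p 2) 0 0
      · have hmem : (t : GLm p 2) ∈ (scalarHom p 2).range := (mem_range_scalarHom_iff _).mpr hns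
        have h1 : (t : GLm p 2) = 1 := hsc _ t.2 hmem
        exact Subtype.ext h1
      · exfalso
        have hdet := det_eq_neg_one_of_sq_eq_one hTT hns
        rw [← hf, hft] at hdet
        apply neg_one_ne_one_units (p := p) hp2
        exact Units.ext (by rw [Units.val_neg, Units.val_one]; exact hdet.symm)
  apply isCyclic_of_injective_ringHom f
  exact (injective_iff_map_eq_one f).mpr key

/-! ### The parity law -/

/-- **Parity law for exceptional subgroups.**  If `H ≤ GL₂(𝔽_p)` (`p` odd) has
`|H| = |H ∩ Z| · N` with `N ∈ {12, 24, 60}` and every element of `H / (H ∩ Z)` (kernel of the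
action on `ℙ¹(K̄)`) has order dividing `2`, `3`, `4` (`N = 24` only) or `5` (`N = 60` only), then
`-1 ∈ H`. -/
theorem neg_one_mem_of_exceptional (hp2 : p ≠ 2) {H : Subgroup (GLm p 2)}
    {N : ℕ} (hN : N = 12 ∨ N = 24 ∨ N = 60)
    (hcard : Nat.card H = Nat.card (actKer H (PL p)) * N)
    (hord : ∀ γ : H, γ ^ 2 ∈ actKer H (PL p) ∨ γ ^ 3 ∈ actKer H (PL p) ∨
      (γ ^ 4 ∈ actKer H (PL p) ∧ N = 24) ∨ (γ ^ 5 ∈ actKer H (PL p) ∧ N = 60)) :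
    scalarHom p 2 (-1) ∈ H := by
  by_contra hneg
  have hodd := not_two_dvd_card_comap_of_neg_one_not_mem hneg
  haveI : Fact (Nat.Prime 2) := ⟨Nat.prime_two⟩
  -- the `2`-part to realise: `d = 4` (`N = 12, 60`) or `d = 8` (`N = 24`)
  obtain ⟨a, d, hd, hdN, hbad⟩ : ∃ a d : ℕ, d = 2 ^ a ∧ d ∣ N ∧
      ∀ e : ℕ, (e = 2 ∨ e = 3 ∨ (e = 4 ∧ N = 24) ∨ (e = 5 ∧ N = 60)) → d ∣ e → False := by
    rcases hN with rfl | rfl | rfl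
    · exact ⟨2, 4, by norm_num, by norm_num, fun e he hde => by
        rcases he with rfl | rfl | ⟨rfl, h⟩ | ⟨rfl, h⟩ <;> omega⟩
    · exact ⟨3, 8, by norm_num, by norm_num, fun e he hde => by
        rcases he with rfl | rfl | ⟨rfl, h⟩ | ⟨rfl, h⟩ <;> omega⟩
    · exact ⟨2, 4, by norm_num, by norm_num, fun e he hde => by
        rcases he with rfl | rfl | ⟨rfl, h⟩ | ⟨rfl, h⟩ <;> omega⟩
  have hdvd : 2 ^ a ∣ Nat.card H := by
    rw [hcard, ← hd]; exact Dvd.dvd.mul_left hdN _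
  obtain ⟨Q', hQ'⟩ := Sylow.exists_subgroup_card_pow_prime 2 hdvd
  set Q : Subgroup (GLm p 2) := Q'.map H.subtype with hQdef
  have hQcard : Nat.card Q = 2 ^ a := by rw [hQdef, Subgroup.card_subtype]; exact hQ'
  have hQH : Q ≤ H := by rw [hQdef]; exact Subgroup.map_subtype_le Q'
  have hsc : ∀ q ∈ Q, q ∈ (scalarHom p 2).range → q = 1 := fun q hq h =>
    eq_one_of_mem_two_subgroup hodd hQH hQcard hq h
  haveI := isCyclic_of_two_subgroup hp2 hQcard hsc
  obtain ⟨g, hg⟩ := IsCyclic.exists_ofOrder_eq_natCard (α := Q)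
  have hgH : (g : GLm p 2) ∈ H := hQH g.2
  -- every admissible exponent `e` with `g ^ e` scalar is a multiple of `d = orderOf g`
  have hpow : ∀ e : ℕ, (⟨(g : GLm p 2), hgH⟩ : H) ^ e ∈ actKer H (PL p) → d ∣ e := by
    intro e he
    rw [mem_actKer_iff_mem_range] at he
    have he' : (g : GLm p 2) ^ e ∈ (scalarHom p 2).range := by simpa using he
    have h1 : (g : GLm p 2) ^ e = 1 := hsc _ (Q.pow_mem g.2 e) he'
    have h2 : g ^ e = 1 := by
      apply Subtype.ext
      simpa using h1
    have := orderOf_dvd_of_pow_eq_one h2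
    rwa [hg, hQcard, ← hd] at this
  rcases hord ⟨g, hgH⟩ with h | h | ⟨h, h24⟩ | ⟨h, h60⟩
  · exact hbad 2 (Or.inl rfl) (hpow 2 h)
  · exact hbad 3 (Or.inr (Or.inl rfl)) (hpow 3 h)
  · exact hbad 4 (Or.inr (Or.inr (Or.inl ⟨rfl, h24⟩))) (hpow 4 h)
  · exact hbad 5 (Or.inr (Or.inr (Or.inr ⟨rfl, h60⟩))) (hpow 5 h)

/-! ### Dickson's list, sharp form -/

/-- **Dickson's list, sharp form** (`p` odd, `n` a non-square): a `p`-free `H ≤ GL₂(𝔽_p)` is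
conjugate into the monomial group, or into the normaliser of the non-split torus `C_n`, or it
contains `-1` and its projective image `H Z / Z` has order exactly `12`, `24` or `60`
(`|H| = |H ∩ Z| · N`). -/
theorem dickson_sharp (hp2 : p ≠ 2) {n : ZMod p} (hn : ∀ x : ZMod p, x * x ≠ n)
    {H : Subgroup (GLm p 2)} (hH : ¬ p ∣ Nat.card H) :
    (∃ g : GLm p 2, ∀ x ∈ H, IsMonomial (g * x * g⁻¹)) ∨
    (∃ g : GLm p 2, ∀ x ∈ H, IsSingerNormal n (g * x * g⁻¹)) ∨
    (scalarHom p 2 (-1) ∈ H ∧ ∃ N : ℕ, (N = 12 ∨ N = 24 ∨ N = 60) ∧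
      Nat.card H = Nat.card (H.comap (scalarHom p 2)) * N ∧
      Nat.card (H.map (QuotientGroup.mk' (scalarHom p 2).range)) = N) := by
  have hfb : ∀ γ : H, MulAction.fixedBy (PL p) γ =
      MulAction.fixedBy (PL p) (γ : GLm p 2) := by
    intro γ; ext x; simp only [MulAction.mem_fixedBy, Subgroup.smul_def]
  have hns_of : ∀ γ : H, γ ∉ actKer H (PL p) → (γ : GLm p 2) ∉ (scalarHom p 2).range :=
    fun γ hγ hmem => hγ ((mem_actKer_iff_mem_range H γ).mpr hmem)
  have h2 : ∀ γ : H, γ ∉ actKer H (PL p) →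
      ∃ x y : PL p, x ≠ y ∧ MulAction.fixedBy (PL p) γ = {x, y} := by
    intro γ hγ
    obtain ⟨E⟩ := exists_eigenData hp2 (disc_ne_zero_of_pfree hp2 hH γ.2 (hns_of γ hγ))
    rw [hfb]
    exact ⟨_, _, E.mk_ne, E.fixedBy_eq_pair⟩
  rcases two_point_action_sharp h2 with hK | ⟨x, y, hxy, ⟨γ₀, hγ₀, hF⟩, hall⟩ |
    ⟨N, hN, hcard, hord⟩
  · -- `H` is scalar
    left
    refine ⟨1, fun x hx => ?_⟩
    have hx' : (⟨x, hx⟩ : H) ∈ actKer H (PL p) := by rw [hK]; exact Subgroup.mem_top _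
    have hsc := (mem_actKer_iff_mem_range H _).mp hx'
    rw [mem_range_scalarHom_iff] at hsc
    rw [one_mul, inv_one, mul_one]
    exact Or.inl ⟨hsc.1, hsc.2.1⟩
  · -- an invariant pair of eigenlines
    have hns := hns_of γ₀ hγ₀
    obtain ⟨E⟩ := exists_eigenData hp2 (disc_ne_zero_of_pfree hp2 hH γ₀.2 hns)
    have hpair : ({x, y} : Set (PL p)) =
        {Projectivization.mk (Kb p) E.u E.hu, Projectivization.mk (Kb p) E.w E.hw} := by
      rw [← hF, hfb]; exact E.fixedBy_eq_pair
    have hfs : ∀ h ∈ H,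
        (h • Projectivization.mk (Kb p) E.u E.hu = Projectivization.mk (Kb p) E.u E.hu ∧
          h • Projectivization.mk (Kb p) E.w E.hw = Projectivization.mk (Kb p) E.w E.hw) ∨
        (h • Projectivization.mk (Kb p) E.u E.hu = Projectivization.mk (Kb p) E.w E.hw ∧
          h • Projectivization.mk (Kb p) E.w E.hw = Projectivization.mk (Kb p) E.u E.hu) := by
      intro h hh
      have hh' := hall ⟨h, hh⟩
      simp only [Subgroup.mk_smul] at hh'
      rcases Set.pair_eq_pair_iff.mp hpair with ⟨hx, hy⟩ | ⟨hx, hy⟩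
      · subst hx hy; exact hh'
      · subst hx hy
        rcases hh' with ⟨e1, e2⟩ | ⟨e1, e2⟩
        · exact Or.inl ⟨e2, e1⟩
        · exact Or.inr ⟨e2, e1⟩
    rcases dickson_of_invariant_pair hp2 hn hH γ₀.2 hns E hfs with h | h
    · exact Or.inl h
    · exact Or.inr (Or.inl h)
  · -- exceptional: parity and the exact image order
    right; right
    refine ⟨neg_one_mem_of_exceptional hp2 hN hcard hord, N, hN, ?_, ?_⟩
    · rw [← card_actKer_eq]; exact hcard
    · have hsc := card_eq_scalar_mul_card_image H
      rw [card_actKer_eq] at hcard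
      have hpos : 0 < Nat.card (H.comap (scalarHom p 2)) := Nat.card_pos
      apply Nat.eq_of_mul_eq_mul_left hpos
      rw [← hsc, hcard]

end ExceptionalParity

end Summit.MatrixMultiplication.MatrixMultiplication.Theorems.SubgroupIdentityDesigns.Negative

end
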